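import Literature.Probability.Percolation.TriTileBoundary
import Literature.Probability.Percolation.TriLoopWinding
import Literature.Probability.Percolation.TriLatticeCells
import HarnessLib

/-!
# The tail polyline of the boundary traversal at mesh `δ`, and the crossing of the exit edge

Topic `Literature/Probability/Percolation`; family `crit-perc`. Plane geometry of the boundary of a
discrete domain read through the tails of its boundary darts (`bdryTail`, `TriTileBoundary.lean`),
placed in `δ𝕋 ⊆ ℂ`, for the winding-number argument replacing Bollobás–Riordan's corner analysis
in the proof of Lemma 14 (*Percolation* (2006), Ch. 7 p. 191: "Let us trace the boundary of `G_δ⁻`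
anticlockwise … the closest boundary arc `Γᵢ⁻` can only switch when we are very close to some
`P_k`"):

* `tailPoly δ G b n k` — **the tail polyline**: the concatenation of the segments joining the mesh
  points of consecutive tails at positions `n, …, n + k` (a `Path`; consecutive tails are equal or
  adjacent, `bdryTail_succ_eq_or_adj`); its range (`range_tailPoly`) and the additivity of the
  crossing defect `Path.crossInc` over its segments (`crossInc_tailPoly`);
* **the two faces on the exit edge of a run**: `jExit K` is the vertex index with
  `oppFace (leftFaceDir u K) (jExit K) = leftFaceDir u (K + 5)` (the face across the side
  `{u, u + e_K}`), the side being `faceVertex _ (jExit K + 1) = u`, `faceVertex _ (jExit K + 2) =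
  u + e_K` (`oppFace_leftFaceDir_jExit`, `faceVertex_leftFaceDir_jExit_succ(_succ)`);
* **at mesh `δ`**: the scaled side/centre lemmas — a closed mesh edge (or mesh point) meeting the
  segment between the scaled centres of `F` and `oppFace F j` is their common side
  (`eq_side_of_mem_segment_mesh`), and the mesh edge from `faceVertex F (j + 1)` to
  `faceVertex F (j + 2)` has crossing defect `+2πi` relative to that segment
  (`crossInc_segment_side_mesh`, from `crossInc_segment_of_cross` and the transversality lemmas of
  `TriLoopWinding.lean`).

## References

* B. Bollobás, O. Riordan, *Percolation*, Cambridge University Press (2006), Ch. 7 §7.2.5 p. 191.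

## Mathlib / tree

Mathlib: `Path.trans`, `Path.segment`, `Path.trans_range`, `Path.range_segment`. Tree:
`ArgumentIncrement.lean` (`Path.crossInc`, `crossInc_trans`, `crossInc_refl`, `crossInc_segment_of_cross`,
`segSide`), `TriLoopWinding.lean` (`segSide_hexCenter_faceVertex_succ(_succ)`,
`exists_cross_hexCenter_oppFace`), `TriLatticeSegments.lean` (`eq_side_of_segment_inter_segment_hexCenter`),
`TriLatticeCells.lean` (`mem_segment_ofReal_mul_iff`), `TriTileBoundary.lean` (`bdryTail`,
`bdryTail_succ_eq_or_adj`), `TriDiscShelling.lean` (`leftFaceDir`), `TriDiscreteDomain.lean`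
(`faceVertex`, `oppFace`).
-/

noncomputable section

open Set Complex Finset Literature.Topology.PlaneTopology Literature.Probability.LatticeModels

namespace Literature.Probability.Percolation

/-! ### The two faces on the exit edge of a run -/

/-- The vertex index of `leftFaceDir u K` opposite the side `{u, u + e_K}`. [folklore] -/
def jExit : Fin 6 → Fin 3 := ![2, 2, 0, 0, 1, 1]

/-- **The face across the side `{u, u + e_K}` of `leftFaceDir u K` is `leftFaceDir u (K + 5)`.** [folklore] -/
theorem oppFace_leftFaceDir_jExit (u : Site 2) (K : Fin 6) : oppFace (leftFaceDir u K) (jExit K) = leftFaceDir u (K + 5) := by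
  fin_cases K <;>
    simp [jExit, oppFace, leftFaceDir, sub_eq_add_neg, add_comm, add_left_comm, add_assoc]

/-- The first vertex of that side is `u`. [folklore] -/
theorem faceVertex_leftFaceDir_jExit_succ (u : Site 2) (K : Fin 6) : faceVertex (leftFaceDir u K) (jExit K + 1) = u := by
  fin_cases K <;>
    simp [jExit, faceVertex, leftFaceDir, sub_eq_add_neg, add_comm, add_left_comm, add_assoc]

/-- The second vertex of that side is `u + e_K`. [folklore] -/
theorem faceVertex_leftFaceDir_jExit_succ_succ (u : Site 2) (K : Fin 6) :
    faceVertex (leftFaceDir u K) (jExit K + 2) = u + triDir K := by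
  fin_cases K <;>
    simp [jExit, faceVertex, leftFaceDir, triDir, sub_eq_add_neg, add_comm, add_left_comm, add_assoc]

/-! ### Scaled centres and sides -/

/-- The centre of the face `F` in `δ𝕋 ⊆ ℂ`. [folklore] -/
def meshCenter (δ : ℝ) (F : HexVertex) : ℂ := (δ : ℂ) * hexCenter F

/-- `segSide` is homogeneous of degree two under real scaling. [folklore] -/
theorem segSide_ofReal_mul (δ : ℝ) (ℓ r z : ℂ) : segSide ((δ : ℂ) * ℓ) ((δ : ℂ) * r) ((δ : ℂ) * z) = δ ^ 2 * segSide ℓ r z := by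
  rw [segSide_eq, segSide_eq]
  simp only [Complex.mul_re, Complex.mul_im, Complex.ofReal_re, Complex.ofReal_im, zero_mul, sub_zero, add_zero]
  ring

/-- Membership in an open segment with endpoints scaled by a real `δ ≠ 0`. [folklore] -/
theorem mem_openSegment_ofReal_mul_iff {δ : ℝ} (hδ : δ ≠ 0) {P Q z : ℂ} :
    z ∈ openSegment ℝ ((δ : ℂ) * P) ((δ : ℂ) * Q) ↔ (δ⁻¹ : ℂ) * z ∈ openSegment ℝ P Q := by
  have hδ' : (δ : ℂ) ≠ 0 := Complex.ofReal_ne_zero.2 hδ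
  constructor
  · rintro ⟨a, b, ha, hb, hab, rfl⟩
    refine ⟨a, b, ha, hb, hab, ?_⟩
    rw [Complex.real_smul, Complex.real_smul, Complex.real_smul, Complex.real_smul]
    field_simp
  · rintro ⟨a, b, ha, hb, hab, h⟩
    refine ⟨a, b, ha, hb, hab, ?_⟩
    rw [Complex.real_smul, Complex.real_smul] at h ⊢
    have := congrArg (fun w => (δ : ℂ) * w) h
    rw [← mul_assoc, mul_inv_cancel₀ hδ', one_mul] at this
    rw [← this]; ring

/-- **At mesh `δ`: a closed mesh edge (or mesh point) meeting the segment between the scaled centres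
of `F` and `oppFace F j` is their common side.** [folklore] -/
theorem eq_side_of_mem_segment_mesh {δ : ℝ} (hδ : δ ≠ 0) {F : HexVertex} {j : Fin 3} {a b : Site 2}
    (hab : a = b ∨ triGraph.Adj a b) {q : ℂ} (hq1 : q ∈ segment ℝ (triMeshPoint δ a) (triMeshPoint δ b))
    (hq2 : q ∈ segment ℝ (meshCenter δ F) (meshCenter δ (oppFace F j))) :
    (a = faceVertex F (j + 1) ∧ b = faceVertex F (j + 2)) ∨ (a = faceVertex F (j + 2) ∧ b = faceVertex F (j + 1)) := by
  rw [triMeshPoint, triMeshPoint, mem_segment_ofReal_mul_iff hδ] at hq1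
  rw [meshCenter, meshCenter, mem_segment_ofReal_mul_iff hδ] at hq2
  exact eq_side_of_segment_inter_segment_hexCenter hab hq1 hq2

/-- **At mesh `δ`: the side from `faceVertex F (j + 1)` to `faceVertex F (j + 2)` crosses the segment
between the scaled centres of `F` and `oppFace F j` once, from the positive to the negative side:
its crossing defect is `+2πi`.** [folklore] -/
theorem crossInc_segment_side_mesh {δ : ℝ} (hδ : 0 < δ) (F : HexVertex) (j : Fin 3) :
    (Path.segment (triMeshPoint δ (faceVertex F (j + 1))) (triMeshPoint δ (faceVertex F (j + 2)))).crossInc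
      (meshCenter δ F) (meshCenter δ (oppFace F j)) = 2 * Real.pi * I := by
  refine Path.crossInc_segment_of_cross ?_ ?_ ?_
  · rw [meshCenter, meshCenter, triMeshPoint, segSide_ofReal_mul, segSide_hexCenter_faceVertex_succ]; positivity
  · rw [meshCenter, meshCenter, triMeshPoint, segSide_ofReal_mul, segSide_hexCenter_faceVertex_succ_succ]
    have : (0 : ℝ) < δ ^ 2 * (Real.sqrt 3 / 6) := by positivity
    linarith
  · obtain ⟨p, hp1, hp2⟩ := exists_cross_hexCenter_oppFace F j
    refine ⟨(δ : ℂ) * p, ?_, ?_⟩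
    · rw [triMeshPoint, triMeshPoint, mem_segment_ofReal_mul_iff hδ.ne', ← mul_assoc, inv_mul_cancel₀ (Complex.ofReal_ne_zero.2 hδ.ne'),
        one_mul]; exact hp1
    · rw [meshCenter, meshCenter, mem_openSegment_ofReal_mul_iff hδ.ne', ← mul_assoc, inv_mul_cancel₀ (Complex.ofReal_ne_zero.2 hδ.ne'),
        one_mul]; exact hp2

/-! ### The tail polyline -/

section TailPoly

variable (δ : ℝ) (G : Finset (Site 2)) (b : Site 2 × Site 2)

/-- The mesh point of the tail at position `n`. [folklore] -/
def tailPt (n : ℕ) : ℂ := triMeshPoint δ (bdryTail G b n)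

/-- **The tail polyline** from position `n` over `k` steps: the concatenation of the segments between
the mesh points of consecutive tails. [folklore] -/
def tailPoly (n : ℕ) : ∀ k : ℕ, Path (tailPt δ G b n) (tailPt δ G b (n + k))
  | 0 => Path.refl _
  | k + 1 => (tailPoly n k).trans (Path.segment (tailPt δ G b (n + k)) (tailPt δ G b (n + k + 1)))

/-- The tail polyline over no step is constant. [folklore] -/
@[simp] theorem tailPoly_zero (n : ℕ) : tailPoly δ G b n 0 = Path.refl _ := rfl

/-- The tail polyline over `k + 1` steps. [folklore] -/
theorem tailPoly_succ (n k : ℕ) :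
    tailPoly δ G b n (k + 1) = (tailPoly δ G b n k).trans (Path.segment (tailPt δ G b (n + k)) (tailPt δ G b (n + k + 1))) := rfl

/-- **The range of the tail polyline** is the union of its segments (and its base point). [folklore] -/
theorem range_tailPoly (n k : ℕ) :
    range (tailPoly δ G b n k) = {tailPt δ G b n} ∪ ⋃ i ∈ Finset.range k, segment ℝ (tailPt δ G b (n + i)) (tailPt δ G b (n + i + 1)) := by
  induction k with
  | zero => simp [tailPoly]
  | succ k ih =>
    rw [tailPoly_succ, Path.trans_range, ih, Path.range_segment, Finset.range_add_one, Finset.set_biUnion_insert]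
    ext z; simp only [mem_union, mem_singleton_iff, mem_iUnion]
    constructor
    · rintro ((h | h) | h)
      · exact Or.inl h
      · exact Or.inr (Or.inr h)
      · exact Or.inr (Or.inl h)
    · rintro (h | h | h)
      · exact Or.inl (Or.inl h)
      · exact Or.inr h
      · exact Or.inl (Or.inr h)

/-- A point off all the segments (and the base point) is off the tail polyline. [folklore] -/
theorem not_mem_range_tailPoly {n k : ℕ} {z : ℂ} (h0 : z ≠ tailPt δ G b n)
    (h : ∀ i < k, z ∉ segment ℝ (tailPt δ G b (n + i)) (tailPt δ G b (n + i + 1))) : z ∉ range (tailPoly δ G b n k) := by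
  rw [range_tailPoly]
  simp only [mem_union, mem_singleton_iff, mem_iUnion, Finset.mem_range, not_or, not_exists]
  exact ⟨h0, fun i hi hz => h i hi hz⟩

/-- **Additivity of the crossing defect over the tail polyline**: if `ℓ` and `r` lie off all its
segments (and its base point), the crossing defect of the tail polyline relative to `[ℓ, r]` is the
sum of those of its segments. [folklore] -/
theorem crossInc_tailPoly {n k : ℕ} {ℓ r : ℂ} (hℓ0 : ℓ ≠ tailPt δ G b n) (hr0 : r ≠ tailPt δ G b n)
    (hℓ : ∀ i < k, ℓ ∉ segment ℝ (tailPt δ G b (n + i)) (tailPt δ G b (n + i + 1)))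
    (hr : ∀ i < k, r ∉ segment ℝ (tailPt δ G b (n + i)) (tailPt δ G b (n + i + 1))) :
    (tailPoly δ G b n k).crossInc ℓ r =
      ∑ i ∈ Finset.range k, (Path.segment (tailPt δ G b (n + i)) (tailPt δ G b (n + i + 1))).crossInc ℓ r := by
  induction k with
  | zero => simp [tailPoly, Path.crossInc_refl]
  | succ k ih =>
    rw [tailPoly_succ, Path.crossInc_trans, ih (fun i hi => hℓ i (by omega)) (fun i hi => hr i (by omega)), Finset.sum_range_succ]
    · exact not_mem_range_tailPoly δ G b hℓ0 fun i hi => hℓ i (by omega)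
    · rw [Path.range_segment]; exact hℓ k (by omega)
    · exact not_mem_range_tailPoly δ G b hr0 fun i hi => hr i (by omega)
    · rw [Path.range_segment]; exact hr k (by omega)

end TailPoly

end Literature.Probability.Percolation

end
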